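import Mathlib
import HarnessLib
import Summits.ResolutionOfSingularities.ResolutionOfSingularities.Theorems.WildQuotientsWildQuotientResolutionS1aA1Move3
import Summits.ResolutionOfSingularities.ResolutionOfSingularities.Theorems.WildQuotientsWildQuotientResolutionS1aA1Move2Ring
import Summits.ResolutionOfSingularities.ResolutionOfSingularities.Theorems.WildQuotientsWildQuotientResolutionS1aA1Move2Regular
import Summits.ResolutionOfSingularities.ResolutionOfSingularities.Theorems.WildQuotientsWildQuotientResolutionS1aA1ModelPins
import Summits.ResolutionOfSingularities.ResolutionOfSingularities.Theorems.WildQuotientsWildQuotientResolutionS1aFreeModelStep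
import Summits.ResolutionOfSingularities.ResolutionOfSingularities.Theorems.WildQuotientsWildQuotientResolutionS1aModelTools
import Summits.ResolutionOfSingularities.ResolutionOfSingularities.Theorems.WildQuotientsWildQuotientResolutionS1aKillFreeShots

/-!
# S1a — INSTANCE I-2 (a1): the LEAF of the kill tree — from the exposed node of `[X₀]₂` (output of `a1_move2`) to `KillsIn 1`

[OURS · L1 W4.5c · lead-1 g13; plan-1 CHAIN v10.40 §4 ASSIGNMENT (iii)/(iv) «A1Move3Model over the localised base … a1_killsIn_three», R-F15c (I-2 := MT-a1″), X-CERT v1 §3 a1 move 3] — NOT statements of the manuscript; counted 0; AI-level work, weaker than expert review. Crux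
stmt-ResolutionOfSingularities-17941 `CyclicQuotientFourfolds`, line `s1a-logminvertex` v13 (`stub_reachLowerInFX`).

* ★★★ `GameFrame.GModel.a1_killsIn_one` — `M₂` a model carrying the output of ✓`a1_move2` (the residual chart `W₂ = [X₀]₂` with its pinned node `E₂` over the model `P = k[x_none, x′][1/h]` of the node of `N(x₁)`: grading `𝒜P` with the degrees of the generators, automorphism `τ_P` with the a1 rows, the cover
  element `y₀`, the ratio section `u₂`, the pulled-back section `u₁`, the cover `M₂ = W₂ ∪ W₂′ ∪ U₁`) and an atlas `𝔄₂` with `F_𝔄₂ ⊆ W₂`: then `KillsIn 1 M₂`. Proof: the FREE MODEL `Q = k[s₂, s, Y₀, X₁, Y₂, x₃][1/(subst h · Y₀^{dpd₂})]` of the node of `W₂` (✓`exists_chartFreeModelEquiv`), the rows of `τ_Q` on its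
  generators from ✓`a1m2_sigmaR_*_sub`, the degrees through the model iso (✓`map_algebraMap_mem_mapGrading`), K1′ for `(s₂, Y₂, s)` (✓`isRegular_algebraMap_X_away`), generation / characteristic / units of `Q`, the two separating sections — and ✓`a1_move3`.
-/

set_option linter.dupNamespace false

noncomputable section

open CategoryTheory Limits AlgebraicGeometry TopologicalSpace Topology Opposite
open Literature.AlgebraicGeometry.Resolution Literature.AlgebraicGeometry.RelativeSpec
open scoped LaurentPolynomial
open MvPolynomial
open Summit.ResolutionOfSingularities.ResolutionOfSingularities.Theorems.WildQuotientResolution.S1 Summit.ResolutionOfSingularities.ResolutionOfSingularities.Theorems.WildQuotientResolution.S1.NodeAtlas Summit.ResolutionOfSingularities.ResolutionOfSingularities.Theorems.WildQuotientResolution.S1.CoarseChart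
open Summit.ResolutionOfSingularities.ResolutionOfSingularities.Theorems.WildQuotientResolution.S1.ProducerStep Summit.ResolutionOfSingularities.ResolutionOfSingularities.Theorems.WildQuotientResolution.S1.NpFrame Summit.ResolutionOfSingularities.ResolutionOfSingularities.Theorems.WildQuotientResolution.S1.GoodCharts
open Summit.ResolutionOfSingularities.ResolutionOfSingularities.Theorems.WildQuotientResolution.S1.BlowupCharts Summit.ResolutionOfSingularities.ResolutionOfSingularities.Theorems.WildQuotientResolution.S1.KillCert Summit.ResolutionOfSingularities.ResolutionOfSingularities.Theorems.WildQuotientResolution.S1.ReesBigrading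
open Summit.ResolutionOfSingularities.ResolutionOfSingularities.Theorems.WildQuotientResolution.S1.NodeTransport Summit.ResolutionOfSingularities.ResolutionOfSingularities.Theorems.WildQuotientResolution.S1.CobordantTransport Summit.ResolutionOfSingularities.ResolutionOfSingularities.Theorems.WildQuotientResolution.S1.FreeModel
open Summit.ResolutionOfSingularities.ResolutionOfSingularities.Theorems.WildQuotientResolution.S1.ModelNode

namespace Summit.ResolutionOfSingularities.ResolutionOfSingularities.Theorems.WildQuotientResolution.S1.GameFrame.GModel

variable {p : ℕ} {X' X₁ : Scheme.{0}} {q : X' ⟶ X₁} {G : Type} [Group G] {ρ : G →* Aut X'} {g₀ : G}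

set_option maxHeartbeats 4000000 in
set_option synthInstance.maxHeartbeats 400000 in
/-- ★★★ **THE LEAF OF THE a1 KILL TREE**: from the exposed node of the residual chart `[X₀]₂` of move 2 to `KillsIn 1`. See the module docstring.
[OURS · L1 W4.5c · R-F15c I-2; NOT a statement of the manuscript] -/
theorem a1_killsIn_one [Finite G] [NeZero p] (hp : p.Prime) (hG : ∀ g : G, g ∈ Subgroup.zpowers g₀) {k : Type} [Field k] [CharP k p]
    (M₂ : GModel p q G ρ g₀) [M₂.V.IsSeparated]
    -- the model `P = k[x_none, x′][1/h]` of the node of `N(x₁)`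
    (hh₁ : MvPolynomial (Option (Fin 4)) k) (d : ℕ) (hd : 0 < d)
    (hhh₁ : hh₁ = (∏ j : ZMod p, (X (some 1) + C (j.val : k) * (X (some 0) * X none))) ^ (2 * d))
    (s₁ X₀ X₁ x₂ x₃ ηinv : Localization.Away hh₁)
    (hs₁ : s₁ = algebraMap (MvPolynomial (Option (Fin 4)) k) (Localization.Away hh₁) (X none))
    (hX₀ : X₀ = algebraMap (MvPolynomial (Option (Fin 4)) k) (Localization.Away hh₁) (X (some 0)))
    (hX₁ : X₁ = algebraMap (MvPolynomial (Option (Fin 4)) k) (Localization.Away hh₁) (X (some 1)))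
    (hx₂ : x₂ = algebraMap (MvPolynomial (Option (Fin 4)) k) (Localization.Away hh₁) (X (some 2)))
    (hx₃ : x₃ = algebraMap (MvPolynomial (Option (Fin 4)) k) (Localization.Away hh₁) (X (some 3)))
    (hηinv : ηinv = IsLocalization.Away.invSelf hh₁)
    {m : ℕ} {r : Fin m → ℕ} (𝒜P : (Π j : Fin m, ZMod (r j)) → AddSubgroup (Localization.Away hh₁)) [GradedRing 𝒜P] (θ : Π j : Fin m, ZMod (r j))
    (τP : Localization.Away hh₁ ≃+* Localization.Away hh₁)
    (r0 : τP s₁ = s₁) (r1 : τP X₀ = X₀) (r2 : τP X₁ = X₁ + X₀ * s₁) (r3 : τP x₂ = x₂ + s₁ ^ 2 * X₀) (r4 : τP x₃ = x₃ + s₁ * X₁ * x₂)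
    (r5 : ∀ g' ∈ (({IsLocalization.Away.invSelf hh₁} : Set (Localization.Away hh₁)) ∪ Set.range (algebraMap k (Localization.Away hh₁))), τP g' = g')
    (rh : τP (algebraMap (MvPolynomial (Option (Fin 4)) k) (Localization.Away hh₁) hh₁) = algebraMap (MvPolynomial (Option (Fin 4)) k) (Localization.Away hh₁) hh₁)
    (hσp₂ : ∀ x : Localization.Away hh₁, (⇑τP)^[p] x = x)
    (dg0 : X₀ ∈ 𝒜P (2 • θ)) (dg1 : X₁ ∈ 𝒜P θ) (dg3 : x₃ ∈ 𝒜P 0) (dgs : s₁ ∈ 𝒜P (-θ)) (dgη : ηinv ∈ 𝒜P (-((d * (2 * p)) • θ)))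
    -- the output of move 2 on `M₂`
    (d₂ : ℕ) (hd₂ : 0 < d₂) (W₂ : M₂.act.StableAffineOpens) (hW₂aff : IsAffineOpen W₂.1)
    (hf₂ : ∀ i, (![X₀, x₂] : Fin 2 → Localization.Away hh₁) i ∈ 𝒜P ((![2 • θ, 0] : Fin 2 → Π j : Fin m, ZMod (r j)) i))
    (hσJ₂ : ∀ n : ℕ, ((weightedFiltration (![X₀, x₂] : Fin 2 → Localization.Away hh₁) ![2, 1]).ideal n).map (τP : Localization.Away hh₁ →+* Localization.Away hh₁) ≤
      (weightedFiltration (![X₀, x₂] : Fin 2 → Localization.Away hh₁) ![2, 1]).ideal n)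
    (y₀ : ↥(𝒜P 0)) (hy₀v : (y₀ : Localization.Away hh₁) = (X₀ ^ (d * p) * ηinv) ^ d₂)
    (hy₀ : y₀ ∈ (traceFiltration 𝒜P (![X₀, x₂] : Fin 2 → Localization.Away hh₁) ![2, 1]).ideal (d₂ * (d * (2 * p)))) (hσy₀ : τP (y₀ : Localization.Away hh₁) = y₀)
    (c₁ : ↥(cobordantAlgebra (![X₀, x₂] : Fin 2 → Localization.Away hh₁) ![2, 1]))
    (hc₁ : (c₁ : (Localization.Away hh₁)[T;T⁻¹]) = LaurentPolynomial.C ((∏ i : ZMod p, (x₂ + (i.val : Localization.Away hh₁) * (s₁ ^ 2 * X₀))) ^ (2 * d * d₂)) *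
      LaurentPolynomial.T (((d₂ * (d * (2 * p)) : ℕ)) : ℤ))
    (E₂ : letI := chartNodeGradedRing r 𝒜P (![X₀, x₂] : Fin 2 → Localization.Away hh₁) ![2, 1] hf₂ (d₂ * (d * (2 * p))) y₀ hy₀;
      Γ(M₂.V, W₂.1) ≃+* ↥(chartNodeGrading r 𝒜P (![X₀, x₂] : Fin 2 → Localization.Away hh₁) ![2, 1] hf₂ (d₂ * (d * (2 * p))) y₀ hy₀ 0))
    (htame₂ : letI := chartNodeGradedRing r 𝒜P (![X₀, x₂] : Fin 2 → Localization.Away hh₁) ![2, 1] hf₂ (d₂ * (d * (2 * p))) y₀ hy₀;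
      IsTameNode p (ChartRing 𝒜P (![X₀, x₂] : Fin 2 → Localization.Away hh₁) ![2, 1] (d₂ * (d * (2 * p))) y₀ hy₀)
        (chartNodeGrading r 𝒜P (![X₀, x₂] : Fin 2 → Localization.Away hh₁) ![2, 1] hf₂ (d₂ * (d * (2 * p))) y₀ hy₀)
        (sigmaChart 𝒜P (![X₀, x₂] : Fin 2 → Localization.Away hh₁) ![2, 1] (d₂ * (d * (2 * p))) y₀ hy₀ τP hσJ₂ hp.pos hσp₂ hσy₀))
    (hE₂ : letI := chartNodeGradedRing r 𝒜P (![X₀, x₂] : Fin 2 → Localization.Away hh₁) ![2, 1] hf₂ (d₂ * (d * (2 * p))) y₀ hy₀; ∀ t' : Γ(M₂.V, W₂.1),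
      ((E₂ ((M₂.act.aut g₀⁻¹).hom.appLE W₂.1 W₂.1 (W₂.2.1 g₀⁻¹).ge t') :
          ↥(chartNodeGrading r 𝒜P (![X₀, x₂] : Fin 2 → Localization.Away hh₁) ![2, 1] hf₂ (d₂ * (d * (2 * p))) y₀ hy₀ 0)) :
          ChartRing 𝒜P (![X₀, x₂] : Fin 2 → Localization.Away hh₁) ![2, 1] (d₂ * (d * (2 * p))) y₀ hy₀) = sigmaChart 𝒜P (![X₀, x₂] : Fin 2 → Localization.Away hh₁) ![2, 1] (d₂ * (d * (2 * p))) y₀ hy₀ τP hσJ₂ hp.pos hσp₂ hσy₀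
          ((E₂ t' : ↥(chartNodeGrading r 𝒜P (![X₀, x₂] : Fin 2 → Localization.Away hh₁) ![2, 1] hf₂ (d₂ * (d * (2 * p))) y₀ hy₀ 0)) :
            ChartRing 𝒜P (![X₀, x₂] : Fin 2 → Localization.Away hh₁) ![2, 1] (d₂ * (d * (2 * p))) y₀ hy₀))
    (W₂' U₁ : M₂.V.Opens) (hcov : ∀ x : M₂.V, x ∈ W₂.1 ∨ x ∈ W₂' ∨ x ∈ U₁)
    (u₂ : Γ(M₂.V, W₂.1))
    (hu₂v : letI := chartNodeGradedRing r 𝒜P (![X₀, x₂] : Fin 2 → Localization.Away hh₁) ![2, 1] hf₂ (d₂ * (d * (2 * p))) y₀ hy₀;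
      ((E₂ u₂ : ↥(chartNodeGrading r 𝒜P (![X₀, x₂] : Fin 2 → Localization.Away hh₁) ![2, 1] hf₂ (d₂ * (d * (2 * p))) y₀ hy₀ 0)) :
          ChartRing 𝒜P (![X₀, x₂] : Fin 2 → Localization.Away hh₁) ![2, 1] (d₂ * (d * (2 * p))) y₀ hy₀) = algebraMap _ (ChartRing 𝒜P (![X₀, x₂] : Fin 2 → Localization.Away hh₁) ![2, 1] (d₂ * (d * (2 * p))) y₀ hy₀) c₁ *
          IsLocalization.Away.invSelf (coverElement 𝒜P (![X₀, x₂] : Fin 2 → Localization.Away hh₁) ![2, 1] (d₂ * (d * (2 * p))) y₀ hy₀))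
    (hu₂U : ∀ v ∈ W₂.1, v ∈ W₂' → v ∈ M₂.V.basicOpen u₂)
    (u₁ : Γ(M₂.V, W₂.1)) (x₁ : ↥(𝒜P 0)) (hx₁v : (x₁ : Localization.Away hh₁) = X₀ ^ (d * p) * ηinv)
    (hu₁v : letI := chartNodeGradedRing r 𝒜P (![X₀, x₂] : Fin 2 → Localization.Away hh₁) ![2, 1] hf₂ (d₂ * (d * (2 * p))) y₀ hy₀;
      ((E₂ u₁ : ↥(chartNodeGrading r 𝒜P (![X₀, x₂] : Fin 2 → Localization.Away hh₁) ![2, 1] hf₂ (d₂ * (d * (2 * p))) y₀ hy₀ 0)) :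
          ChartRing 𝒜P (![X₀, x₂] : Fin 2 → Localization.Away hh₁) ![2, 1] (d₂ * (d * (2 * p))) y₀ hy₀) = toChartRing 𝒜P (![X₀, x₂] : Fin 2 → Localization.Away hh₁) ![2, 1] (d₂ * (d * (2 * p))) y₀ hy₀ x₁)
    (hu₁U : ∀ v ∈ W₂.1, v ∈ U₁ → v ∈ M₂.V.basicOpen u₁)
    (𝔄₂ : NodeAtlasData p M₂.act g₀) (hF₂ : 𝔄₂.fLocus ⊆ (W₂.1 : Set M₂.V)) :
    KillsIn 1 M₂ := by
  classical
  subst hs₁ hX₀ hX₁ hx₂ hx₃ hηinv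
  letI instN := chartNodeGradedRing r 𝒜P (![algebraMap (MvPolynomial (Option (Fin 4)) k) (Localization.Away hh₁) (X (some 0)),
    algebraMap (MvPolynomial (Option (Fin 4)) k) (Localization.Away hh₁) (X (some 2))] : Fin 2 → Localization.Away hh₁) ![2, 1] hf₂ (d₂ * (d * (2 * p))) y₀ hy₀
  have hp1 : p ≠ 1 := hp.one_lt.ne'
  have hdp : 0 < d * p := Nat.mul_pos hd hp.pos
  -- ### the free model `Q` of the node of `W₂`
  have hv : Function.Injective (![some 0, some 2] : Fin 2 → Option (Fin 4)) := by
    intro i j hij; fin_cases i <;> fin_cases j <;> first | rfl | exact absurd hij (by decide)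
  have hvW : ∀ i, (fun o : Option (Fin 4) => Option.elim o 0 ![2, 0, 1, 0]) ((![some 0, some 2] : Fin 2 → Option (Fin 4)) i) = (![2, 1] : Fin 2 → ℕ) i := by
    intro i; fin_cases i <;> rfl
  have hW : ∀ l : Option (Fin 4), (fun o : Option (Fin 4) => Option.elim o 0 ![2, 0, 1, 0]) l = 0 ∨ ∃ i, (![some 0, some 2] : Fin 2 → Option (Fin 4)) i = l := by
    rintro (_ | l)
    · exact Or.inl rfl
    · fin_cases l
      · exact Or.inr ⟨0, rfl⟩
      · exact Or.inl rfl
      · exact Or.inr ⟨1, rfl⟩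
      · exact Or.inl rfl
  have hf₂' : ∀ i, (![algebraMap (MvPolynomial (Option (Fin 4)) k) (Localization.Away hh₁) (X (some 0)),
      algebraMap (MvPolynomial (Option (Fin 4)) k) (Localization.Away hh₁) (X (some 2))] : Fin 2 → Localization.Away hh₁) i = algebraMap (MvPolynomial (Option (Fin 4)) k) (Localization.Away hh₁) (X ((![some 0, some 2] : Fin 2 → Option (Fin 4)) i)) := by
    intro i; fin_cases i <;> rfl
  have hηu : IsUnit (IsLocalization.Away.invSelf hh₁) :=
    IsUnit.of_mul_eq_one (algebraMap (MvPolynomial (Option (Fin 4)) k) (Localization.Away hh₁) hh₁)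
      ((mul_comm _ _).trans (IsLocalization.Away.mul_invSelf hh₁))
  -- the cover element of `W₂` in `R₂`, as a product of generators
  have hc0R : coverElement 𝒜P (![algebraMap (MvPolynomial (Option (Fin 4)) k) (Localization.Away hh₁) (X (some 0)),
      algebraMap (MvPolynomial (Option (Fin 4)) k) (Localization.Away hh₁) (X (some 2))] : Fin 2 → Localization.Away hh₁) ![2, 1] (d₂ * (d * (2 * p))) y₀ hy₀ = cobordantAlgebra.u' _ ![2, 1] 0 ^ (d * p * d₂) * algebraMap (Localization.Away hh₁) _ (IsLocalization.Away.invSelf hh₁ ^ d₂) := by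
    have e1 : ((LaurentPolynomial.C (algebraMap (MvPolynomial (Option (Fin 4)) k) (Localization.Away hh₁) (X (some 0))) * LaurentPolynomial.T ((2 : ℕ) : ℤ)) ^ (d * p * d₂) *
        LaurentPolynomial.C (IsLocalization.Away.invSelf hh₁ ^ d₂) : (Localization.Away hh₁)[T;T⁻¹]) = LaurentPolynomial.C (algebraMap (MvPolynomial (Option (Fin 4)) k) (Localization.Away hh₁) (X (some 0)) ^ (d * p * d₂) * IsLocalization.Away.invSelf hh₁ ^ d₂) *
          LaurentPolynomial.T (((d * p * d₂ : ℕ) : ℤ) * ((2 : ℕ) : ℤ)) := by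
      rw [mul_pow, ← map_pow, LaurentPolynomial.T_pow, mul_right_comm, ← map_mul]
    have e2 : (algebraMap (MvPolynomial (Option (Fin 4)) k) (Localization.Away hh₁) (X (some 0)) ^ (d * p) * IsLocalization.Away.invSelf hh₁) ^ d₂ = algebraMap (MvPolynomial (Option (Fin 4)) k) (Localization.Away hh₁) (X (some 0)) ^ (d * p * d₂) * IsLocalization.Away.invSelf hh₁ ^ d₂ := by
      rw [mul_pow, ← pow_mul]
    refine Subtype.ext ?_
    rw [coe_coverElement, hy₀v, e2, MulMemClass.coe_mul, SubmonoidClass.coe_pow, cobordantAlgebra.coe_u', cobordantAlgebra.coe_algebraMap]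
    change _ = (LaurentPolynomial.C (algebraMap (MvPolynomial (Option (Fin 4)) k) (Localization.Away hh₁) (X (some 0))) * LaurentPolynomial.T ((2 : ℕ) : ℤ)) ^ (d * p * d₂) *
      LaurentPolynomial.C (IsLocalization.Away.invSelf hh₁ ^ d₂)
    rw [e1, show ((d * p * d₂ : ℕ) : ℤ) * ((2 : ℕ) : ℤ) = ((d₂ * (d * (2 * p)) : ℕ) : ℤ) by push_cast; ring]
  have hz : ∀ Ψ : ↥(cobordantAlgebra (![algebraMap (MvPolynomial (Option (Fin 4)) k) (Localization.Away hh₁) (X (some 0)),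
      algebraMap (MvPolynomial (Option (Fin 4)) k) (Localization.Away hh₁) (X (some 2))] : Fin 2 → Localization.Away hh₁) ![2, 1]) ≃+*
        Localization.Away (cobordantAlgebra.subst k (fun o : Option (Fin 4) => Option.elim o 0 ![2, 0, 1, 0]) hh₁),
      (∀ a : MvPolynomial (Option (Fin 4)) k, Ψ (algebraMap (Localization.Away hh₁) _ (algebraMap (MvPolynomial (Option (Fin 4)) k) (Localization.Away hh₁) a)) =
          algebraMap (MvPolynomial (Option (Option (Fin 4))) k) _ (cobordantAlgebra.subst k (fun o : Option (Fin 4) => Option.elim o 0 ![2, 0, 1, 0]) a)) →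
      Ψ (cobordantAlgebra.s _ ![2, 1]) = algebraMap (MvPolynomial (Option (Option (Fin 4))) k) _ (X none) →
      (∀ i, Ψ (cobordantAlgebra.u' _ ![2, 1] i) = algebraMap (MvPolynomial (Option (Option (Fin 4))) k) _ (X (some ((![some 0, some 2] : Fin 2 → Option (Fin 4)) i)))) →
      Associated (algebraMap (MvPolynomial (Option (Option (Fin 4))) k) (Localization.Away (cobordantAlgebra.subst k (fun o : Option (Fin 4) => Option.elim o 0 ![2, 0, 1, 0]) hh₁))
        (X (some (some 0)) ^ (d * p * d₂)))
        (Ψ (coverElement 𝒜P (![algebraMap (MvPolynomial (Option (Fin 4)) k) (Localization.Away hh₁) (X (some 0)),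
          algebraMap (MvPolynomial (Option (Fin 4)) k) (Localization.Away hh₁) (X (some 2))] : Fin 2 → Localization.Away hh₁) ![2, 1] (d₂ * (d * (2 * p))) y₀ hy₀)) := by
    intro Ψ _ _ hu
    have hU : IsUnit (Ψ (algebraMap (Localization.Away hh₁) _ (IsLocalization.Away.invSelf hh₁))) := (hηu.map _).map Ψ
    refine ⟨(hU.pow d₂).unit, ?_⟩
    rw [IsUnit.unit_spec, hc0R]
    simp only [map_pow, map_mul, hu 0, Matrix.cons_val_zero]
  obtain ⟨Φ₂, hΦa, hΦs, hΦu⟩ := exists_chartFreeModelEquiv k (fun o : Option (Fin 4) => Option.elim o 0 ![2, 0, 1, 0]) hh₁ (![some 0, some 2]) ![2, 1] hvW hW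
    _ hf₂' 𝒜P (d₂ * (d * (2 * p))) y₀ hy₀ (X (some (some 0)) ^ (d * p * d₂)) hz
  -- ### the dictionary `Φ₂ ∘ (P → R₂ → ChartRing)` on generators
  have hsub : ∀ o : Option (Fin 4), cobordantAlgebra.subst k (fun o : Option (Fin 4) => Option.elim o 0 ![2, 0, 1, 0]) (X o) = X none ^ ((fun o : Option (Fin 4) => Option.elim o 0 ![2, 0, 1, 0]) o) * X (some o) := fun o => by
    rw [cobordantAlgebra.subst, MvPolynomial.eval₂Hom_X']
  have hΦX0 : Φ₂ (algebraMap ↥(cobordantAlgebra (![algebraMap (MvPolynomial (Option (Fin 4)) k) (Localization.Away hh₁) (X (some 0)), algebraMap (MvPolynomial (Option (Fin 4)) k) (Localization.Away hh₁) (X (some 2))] : Fin 2 → Localization.Away hh₁) ![2, 1]) (ChartRing 𝒜P (![algebraMap (MvPolynomial (Option (Fin 4)) k) (Localization.Away hh₁) (X (some 0)), algebraMap (MvPolynomial (Option (Fin 4)) k) (Localization.Away hh₁) (X (some 2))] : Fin 2 → Localization.Away hh₁) ![2, 1] (d₂ * (d * (2 * p))) y₀ hy₀) (algebraMap (Localization.Away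 hh₁) ↥(cobordantAlgebra (![algebraMap (MvPolynomial (Option (Fin 4)) k) (Localization.Away hh₁) (X (some 0)), algebraMap (MvPolynomial (Option (Fin 4)) k) (Localization.Away hh₁) (X (some 2))] : Fin 2 → Localization.Away hh₁) ![2, 1]) (algebraMap (MvPolynomial (Option (Fin 4)) k) (Localization.Away hh₁) (X (some 0))))) = algebraMap (MvPolynomial (Option (Option (Fin 4))) k) _ (X none) ^ 2 * algebraMap (MvPolynomial (Option (Option (Fin 4))) k) _ (X (some (some 0))) := by
    rw [hΦa, hsub, map_mul, map_pow]; rfl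
  have hΦX1 : Φ₂ (algebraMap ↥(cobordantAlgebra (![algebraMap (MvPolynomial (Option (Fin 4)) k) (Localization.Away hh₁) (X (some 0)), algebraMap (MvPolynomial (Option (Fin 4)) k) (Localization.Away hh₁) (X (some 2))] : Fin 2 → Localization.Away hh₁) ![2, 1]) (ChartRing 𝒜P (![algebraMap (MvPolynomial (Option (Fin 4)) k) (Localization.Away hh₁) (X (some 0)), algebraMap (MvPolynomial (Option (Fin 4)) k) (Localization.Away hh₁) (X (some 2))] : Fin 2 → Localization.Away hh₁) ![2, 1] (d₂ * (d * (2 * p))) y₀ hy₀) (algebraMap (Localization.Away hh₁) ↥(cobordantAlgebra (![algebraMap (MvPolynomial (Option (Fin 4)) k) (Localization.Away hh₁) (X (some 0)), algebraMap (MvPolynomial (Option (Fin 4)) k) (Localization.Away hh₁) (X (some 2))] : Fin 2 → Localization.Away hh₁) ![2, 1]) (algebraMap (MvPolynomial (Option (Fin 4)) k) (Localization.Away hh₁) (X (some 1))))) = algebraMap (MvPolynomial (Option (Option (Fin 4))) k) _ (X (some (some 1))) := by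
    rw [hΦa, hsub]; change algebraMap _ _ (X none ^ 0 * _) = _; rw [pow_zero, one_mul]
  have hΦx2 : Φ₂ (algebraMap ↥(cobordantAlgebra (![algebraMap (MvPolynomial (Option (Fin 4)) k) (Localization.Away hh₁) (X (some 0)), algebraMap (MvPolynomial (Option (Fin 4)) k) (Localization.Away hh₁) (X (some 2))] : Fin 2 → Localization.Away hh₁) ![2, 1]) (ChartRing 𝒜P (![algebraMap (MvPolynomial (Option (Fin 4)) k) (Localization.Away hh₁) (X (some 0)), algebraMap (MvPolynomial (Option (Fin 4)) k) (Localization.Away hh₁) (X (some 2))] : Fin 2 → Localization.Away hh₁) ![2, 1] (d₂ * (d * (2 * p))) y₀ hy₀) (algebraMap (Localization.Away hh₁) ↥(cobordantAlgebra (![algebraMap (MvPolynomial (Option (Fin 4)) k) (Localization.Away hh₁) (X (some 0)), algebraMap (MvPolynomial (Option (Fin 4)) k) (Localization.Away hh₁) (X (some 2))] : Fin 2 → Localization.Away hh₁) ![2, 1]) (algebraMap (MvPolynomial (Option (Fin 4)) k) (Localization.Away hh₁) (X (some 2))))) = algebraMap (MvPolynomial (Option (Option (Fin 4))) k) _ (X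 none) * algebraMap (MvPolynomial (Option (Option (Fin 4))) k) _ (X (some (some 2))) := by
    rw [hΦa, hsub, map_mul]; change algebraMap _ _ (X none ^ 1) * _ = _; rw [pow_one]
  have hΦx3 : Φ₂ (algebraMap ↥(cobordantAlgebra (![algebraMap (MvPolynomial (Option (Fin 4)) k) (Localization.Away hh₁) (X (some 0)), algebraMap (MvPolynomial (Option (Fin 4)) k) (Localization.Away hh₁) (X (some 2))] : Fin 2 → Localization.Away hh₁) ![2, 1]) (ChartRing 𝒜P (![algebraMap (MvPolynomial (Option (Fin 4)) k) (Localization.Away hh₁) (X (some 0)), algebraMap (MvPolynomial (Option (Fin 4)) k) (Localization.Away hh₁) (X (some 2))] : Fin 2 → Localization.Away hh₁) ![2, 1] (d₂ * (d * (2 * p))) y₀ hy₀) (algebraMap (Localization.Away hh₁) ↥(cobordantAlgebra (![algebraMap (MvPolynomial (Option (Fin 4)) k) (Localization.Away hh₁) (X (some 0)), algebraMap (MvPolynomial (Option (Fin 4)) k) (Localization.Away hh₁) (X (some 2))] : Fin 2 → Localization.Away hh₁) ![2, 1]) (algebraMap (MvPolynomial (Option (Fin 4)) k) (Localization.Away hh₁)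 (X (some 3))))) = algebraMap (MvPolynomial (Option (Option (Fin 4))) k) _ (X (some (some 3))) := by
    rw [hΦa, hsub]; change algebraMap _ _ (X none ^ 0 * _) = _; rw [pow_zero, one_mul]
  have hΦs₁ : Φ₂ (algebraMap ↥(cobordantAlgebra (![algebraMap (MvPolynomial (Option (Fin 4)) k) (Localization.Away hh₁) (X (some 0)), algebraMap (MvPolynomial (Option (Fin 4)) k) (Localization.Away hh₁) (X (some 2))] : Fin 2 → Localization.Away hh₁) ![2, 1]) (ChartRing 𝒜P (![algebraMap (MvPolynomial (Option (Fin 4)) k) (Localization.Away hh₁) (X (some 0)), algebraMap (MvPolynomial (Option (Fin 4)) k) (Localization.Away hh₁) (X (some 2))] : Fin 2 → Localization.Away hh₁) ![2, 1] (d₂ * (d * (2 * p))) y₀ hy₀) (algebraMap (Localization.Away hh₁) ↥(cobordantAlgebra (![algebraMap (MvPolynomial (Option (Fin 4)) k) (Localization.Away hh₁) (X (some 0)), algebraMap (MvPolynomial (Option (Fin 4)) k) (Localization.Away hh₁) (X (some 2))] : Fin 2 → Localization.Away hh₁) ![2, 1]) (algebraMap (MvPolynomial (Option (Fin 4)) k)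 (Localization.Away hh₁) (X none)))) = algebraMap (MvPolynomial (Option (Option (Fin 4))) k) _ (X (some none)) := by
    rw [hΦa, hsub]; change algebraMap _ _ (X none ^ 0 * _) = _; rw [pow_zero, one_mul]
  have hΦC : ∀ a : k, Φ₂ (algebraMap ↥(cobordantAlgebra (![algebraMap (MvPolynomial (Option (Fin 4)) k) (Localization.Away hh₁) (X (some 0)), algebraMap (MvPolynomial (Option (Fin 4)) k) (Localization.Away hh₁) (X (some 2))] : Fin 2 → Localization.Away hh₁) ![2, 1]) (ChartRing 𝒜P (![algebraMap (MvPolynomial (Option (Fin 4)) k) (Localization.Away hh₁) (X (some 0)), algebraMap (MvPolynomial (Option (Fin 4)) k) (Localization.Away hh₁) (X (some 2))] : Fin 2 → Localization.Away hh₁) ![2, 1] (d₂ * (d * (2 * p))) y₀ hy₀) (algebraMap (Localization.Away hh₁) ↥(cobordantAlgebra (![algebraMap (MvPolynomial (Option (Fin 4)) k) (Localization.Away hh₁) (X (some 0)), algebraMap (MvPolynomial (Option (Fin 4)) k) (Localization.Away hh₁) (X (some 2))] : Fin 2 → Localization.Away hh₁) ![2, 1]) (algebraMap (MvPolynomial (Option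 (Fin 4)) k) (Localization.Away hh₁) (C a)))) = algebraMap (MvPolynomial (Option (Option (Fin 4))) k) _ (C a) := fun a => by
    rw [hΦa, cobordantAlgebra.subst, MvPolynomial.eval₂Hom_C]
  have hΦY0 : Φ₂ (algebraMap ↥(cobordantAlgebra (![algebraMap (MvPolynomial (Option (Fin 4)) k) (Localization.Away hh₁) (X (some 0)), algebraMap (MvPolynomial (Option (Fin 4)) k) (Localization.Away hh₁) (X (some 2))] : Fin 2 → Localization.Away hh₁) ![2, 1]) (ChartRing 𝒜P (![algebraMap (MvPolynomial (Option (Fin 4)) k) (Localization.Away hh₁) (X (some 0)), algebraMap (MvPolynomial (Option (Fin 4)) k) (Localization.Away hh₁) (X (some 2))] : Fin 2 → Localization.Away hh₁) ![2, 1] (d₂ * (d * (2 * p))) y₀ hy₀) (cobordantAlgebra.u' (![algebraMap (MvPolynomial (Option (Fin 4)) k) (Localization.Away hh₁) (X (some 0)), algebraMap (MvPolynomial (Option (Fin 4)) k) (Localization.Away hh₁) (X (some 2))] : Fin 2 → Localization.Away hh₁) ![2, 1] 0)) = algebraMap (MvPolynomial (Option (Option (Fin 4))) k) _ (X (some (some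 0))) := hΦu 0
  have hΦY2 : Φ₂ (algebraMap ↥(cobordantAlgebra (![algebraMap (MvPolynomial (Option (Fin 4)) k) (Localization.Away hh₁) (X (some 0)), algebraMap (MvPolynomial (Option (Fin 4)) k) (Localization.Away hh₁) (X (some 2))] : Fin 2 → Localization.Away hh₁) ![2, 1]) (ChartRing 𝒜P (![algebraMap (MvPolynomial (Option (Fin 4)) k) (Localization.Away hh₁) (X (some 0)), algebraMap (MvPolynomial (Option (Fin 4)) k) (Localization.Away hh₁) (X (some 2))] : Fin 2 → Localization.Away hh₁) ![2, 1] (d₂ * (d * (2 * p))) y₀ hy₀) (cobordantAlgebra.u' (![algebraMap (MvPolynomial (Option (Fin 4)) k) (Localization.Away hh₁) (X (some 0)), algebraMap (MvPolynomial (Option (Fin 4)) k) (Localization.Away hh₁) (X (some 2))] : Fin 2 → Localization.Away hh₁) ![2, 1] 1)) = algebraMap (MvPolynomial (Option (Option (Fin 4))) k) _ (X (some (some 2))) := hΦu 1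
  -- ### rows of `τ_Q = Φ₂⁻¹ ≫ σ_chart ≫ Φ₂`
  have hτQ : ∀ b, conj Φ₂ (sigmaChart 𝒜P (![algebraMap (MvPolynomial (Option (Fin 4)) k) (Localization.Away hh₁) (X (some 0)), algebraMap (MvPolynomial (Option (Fin 4)) k) (Localization.Away hh₁) (X (some 2))] : Fin 2 → Localization.Away hh₁) ![2, 1] (d₂ * (d * (2 * p))) y₀ hy₀ τP hσJ₂ hp.pos hσp₂ hσy₀) (Φ₂ b) = Φ₂ ((sigmaChart 𝒜P (![algebraMap (MvPolynomial (Option (Fin 4)) k) (Localization.Away hh₁) (X (some 0)), algebraMap (MvPolynomial (Option (Fin 4)) k) (Localization.Away hh₁) (X (some 2))] : Fin 2 → Localization.Away hh₁) ![2, 1] (d₂ * (d * (2 * p))) y₀ hy₀ τP hσJ₂ hp.pos hσp₂ hσy₀) b) := fun b => conj_apply_map Φ₂ _ b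
  have hσs₂ : conj Φ₂ (sigmaChart 𝒜P (![algebraMap (MvPolynomial (Option (Fin 4)) k) (Localization.Away hh₁) (X (some 0)), algebraMap (MvPolynomial (Option (Fin 4)) k) (Localization.Away hh₁) (X (some 2))] : Fin 2 → Localization.Away hh₁) ![2, 1] (d₂ * (d * (2 * p))) y₀ hy₀ τP hσJ₂ hp.pos hσp₂ hσy₀) (algebraMap (MvPolynomial (Option (Option (Fin 4))) k) _ (X none)) = algebraMap (MvPolynomial (Option (Option (Fin 4))) k) _ (X none) := by
    rw [← hΦs, hτQ]; rw [sigmaChart_algebraMap, sigmaR_s]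
  have hσY0 : conj Φ₂ (sigmaChart 𝒜P (![algebraMap (MvPolynomial (Option (Fin 4)) k) (Localization.Away hh₁) (X (some 0)), algebraMap (MvPolynomial (Option (Fin 4)) k) (Localization.Away hh₁) (X (some 2))] : Fin 2 → Localization.Away hh₁) ![2, 1] (d₂ * (d * (2 * p))) y₀ hy₀ τP hσJ₂ hp.pos hσp₂ hσy₀) (algebraMap (MvPolynomial (Option (Option (Fin 4))) k) _ (X (some (some 0)))) =
      algebraMap (MvPolynomial (Option (Option (Fin 4))) k) _ (X (some (some 0))) := by
    rw [← hΦY0, hτQ]; rw [sigmaChart_algebraMap]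
    congr 2
    refine Subtype.ext ?_
    rw [coe_sigmaR, cobordantAlgebra.coe_u', sigmaT_C_mul_T]
    change LaurentPolynomial.C (τP (algebraMap (MvPolynomial (Option (Fin 4)) k) (Localization.Away hh₁) (X (some 0)))) * _ = _
    rw [r1]
    rfl
  have hσY2 : conj Φ₂ (sigmaChart 𝒜P (![algebraMap (MvPolynomial (Option (Fin 4)) k) (Localization.Away hh₁) (X (some 0)), algebraMap (MvPolynomial (Option (Fin 4)) k) (Localization.Away hh₁) (X (some 2))] : Fin 2 → Localization.Away hh₁) ![2, 1] (d₂ * (d * (2 * p))) y₀ hy₀ τP hσJ₂ hp.pos hσp₂ hσy₀) (algebraMap (MvPolynomial (Option (Option (Fin 4))) k) _ (X (some (some 2)))) =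
      algebraMap (MvPolynomial (Option (Option (Fin 4))) k) _ (X (some (some 2))) +
        algebraMap (MvPolynomial (Option (Option (Fin 4))) k) _ (X (some none)) ^ 2 * algebraMap (MvPolynomial (Option (Option (Fin 4))) k) _ (X (some (some 0))) *
          algebraMap (MvPolynomial (Option (Option (Fin 4))) k) _ (X none) := by
    rw [← hΦY2, hτQ]
    rw [sigmaChart_algebraMap, eq_add_of_sub_eq' (A1.a1m2_sigmaR_u'_one_sub τP _ _ _ r3 hp.pos hσp₂ hσJ₂)]
    simp only [map_add, map_mul]
    rw [hΦY2, hΦs, hΦs₁, hΦY0]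
    ring
  have hσX1 : conj Φ₂ (sigmaChart 𝒜P (![algebraMap (MvPolynomial (Option (Fin 4)) k) (Localization.Away hh₁) (X (some 0)), algebraMap (MvPolynomial (Option (Fin 4)) k) (Localization.Away hh₁) (X (some 2))] : Fin 2 → Localization.Away hh₁) ![2, 1] (d₂ * (d * (2 * p))) y₀ hy₀ τP hσJ₂ hp.pos hσp₂ hσy₀) (algebraMap (MvPolynomial (Option (Option (Fin 4))) k) _ (X (some (some 1)))) =
      algebraMap (MvPolynomial (Option (Option (Fin 4))) k) _ (X (some (some 1))) +
        algebraMap (MvPolynomial (Option (Option (Fin 4))) k) _ (X none) ^ 2 * algebraMap (MvPolynomial (Option (Option (Fin 4))) k) _ (X (some (some 0))) *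
          algebraMap (MvPolynomial (Option (Option (Fin 4))) k) _ (X (some none)) := by
    rw [← hΦX1, hτQ]
    rw [sigmaChart_algebraMap, eq_add_of_sub_eq' (A1.a1m2_sigmaR_X₁_sub τP _ _ _ _ r2 hp.pos hσp₂ hσJ₂)]
    simp only [map_add, map_mul]
    rw [hΦX1, hΦs, hΦs₁, hΦY0]
    ring
  have hσx3 : conj Φ₂ (sigmaChart 𝒜P (![algebraMap (MvPolynomial (Option (Fin 4)) k) (Localization.Away hh₁) (X (some 0)), algebraMap (MvPolynomial (Option (Fin 4)) k) (Localization.Away hh₁) (X (some 2))] : Fin 2 → Localization.Away hh₁) ![2, 1] (d₂ * (d * (2 * p))) y₀ hy₀ τP hσJ₂ hp.pos hσp₂ hσy₀) (algebraMap (MvPolynomial (Option (Option (Fin 4))) k) _ (X (some (some 3)))) =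
      algebraMap (MvPolynomial (Option (Option (Fin 4))) k) _ (X (some (some 3))) +
        algebraMap (MvPolynomial (Option (Option (Fin 4))) k) _ (X (some none)) * algebraMap (MvPolynomial (Option (Option (Fin 4))) k) _ (X (some (some 1))) *
          (algebraMap (MvPolynomial (Option (Option (Fin 4))) k) _ (X none) * algebraMap (MvPolynomial (Option (Option (Fin 4))) k) _ (X (some (some 2)))) := by
    rw [← hΦx3, hτQ]
    rw [sigmaChart_algebraMap, eq_add_of_sub_eq' (A1.a1m2_sigmaR_x₃_sub τP _ _ _ _ _ r4 hp.pos hσp₂ hσJ₂)]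
    simp only [map_add, map_mul]
    rw [hΦx3, hΦs, hΦs₁, hΦX1, hΦY2]
    ring
  have hσs : conj Φ₂ (sigmaChart 𝒜P (![algebraMap (MvPolynomial (Option (Fin 4)) k) (Localization.Away hh₁) (X (some 0)), algebraMap (MvPolynomial (Option (Fin 4)) k) (Localization.Away hh₁) (X (some 2))] : Fin 2 → Localization.Away hh₁) ![2, 1] (d₂ * (d * (2 * p))) y₀ hy₀ τP hσJ₂ hp.pos hσp₂ hσy₀) (algebraMap (MvPolynomial (Option (Option (Fin 4))) k) _ (X (some none))) = algebraMap (MvPolynomial (Option (Option (Fin 4))) k) _ (X (some none)) := by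
    rw [← hΦs₁, hτQ]; rw [sigmaChart_algebraMap, sigmaR_algebraMap, r0]
  have hση : conj Φ₂ (sigmaChart 𝒜P (![algebraMap (MvPolynomial (Option (Fin 4)) k) (Localization.Away hh₁) (X (some 0)), algebraMap (MvPolynomial (Option (Fin 4)) k) (Localization.Away hh₁) (X (some 2))] : Fin 2 → Localization.Away hh₁) ![2, 1] (d₂ * (d * (2 * p))) y₀ hy₀ τP hσJ₂ hp.pos hσp₂ hσy₀) (Φ₂ (algebraMap ↥(cobordantAlgebra (![algebraMap (MvPolynomial (Option (Fin 4)) k) (Localization.Away hh₁) (X (some 0)), algebraMap (MvPolynomial (Option (Fin 4)) k) (Localization.Away hh₁) (X (some 2))] : Fin 2 → Localization.Away hh₁) ![2, 1]) (ChartRing 𝒜P (![algebraMap (MvPolynomial (Option (Fin 4)) k) (Localization.Away hh₁) (X (some 0)), algebraMap (MvPolynomial (Option (Fin 4)) k) (Localization.Away hh₁) (X (some 2))] : Fin 2 → Localization.Away hh₁) ![2, 1] (d₂ * (d * (2 * p))) y₀ hy₀) (algebraMap (Localization.Away hh₁) ↥(cobordantAlgebra (![algebraMap (MvPolynomial (Option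 (Fin 4)) k) (Localization.Away hh₁) (X (some 0)), algebraMap (MvPolynomial (Option (Fin 4)) k) (Localization.Away hh₁) (X (some 2))] : Fin 2 → Localization.Away hh₁) ![2, 1]) (IsLocalization.Away.invSelf hh₁)))) =
      Φ₂ (algebraMap ↥(cobordantAlgebra (![algebraMap (MvPolynomial (Option (Fin 4)) k) (Localization.Away hh₁) (X (some 0)), algebraMap (MvPolynomial (Option (Fin 4)) k) (Localization.Away hh₁) (X (some 2))] : Fin 2 → Localization.Away hh₁) ![2, 1]) (ChartRing 𝒜P (![algebraMap (MvPolynomial (Option (Fin 4)) k) (Localization.Away hh₁) (X (some 0)), algebraMap (MvPolynomial (Option (Fin 4)) k) (Localization.Away hh₁) (X (some 2))] : Fin 2 → Localization.Away hh₁) ![2, 1] (d₂ * (d * (2 * p))) y₀ hy₀) (algebraMap (Localization.Away hh₁) ↥(cobordantAlgebra (![algebraMap (MvPolynomial (Option (Fin 4)) k) (Localization.Away hh₁) (X (some 0)), algebraMap (MvPolynomial (Option (Fin 4)) k) (Localization.Away hh₁) (X (some 2))] : Fin 2 → Localization.Away hh₁) ![2, 1]) (IsLocalization.Away.invSelf hh₁)))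 := by
    rw [hτQ]
    rw [sigmaChart_algebraMap, sigmaR_algebraMap, r5 _ (Set.mem_union_left _ (Set.mem_singleton _))]
  have hσκ : conj Φ₂ (sigmaChart 𝒜P (![algebraMap (MvPolynomial (Option (Fin 4)) k) (Localization.Away hh₁) (X (some 0)), algebraMap (MvPolynomial (Option (Fin 4)) k) (Localization.Away hh₁) (X (some 2))] : Fin 2 → Localization.Away hh₁) ![2, 1] (d₂ * (d * (2 * p))) y₀ hy₀ τP hσJ₂ hp.pos hσp₂ hσy₀) (Φ₂ (IsLocalization.Away.invSelf (coverElement 𝒜P _ ![2, 1] (d₂ * (d * (2 * p))) y₀ hy₀))) =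
      Φ₂ (IsLocalization.Away.invSelf (coverElement 𝒜P _ ![2, 1] (d₂ * (d * (2 * p))) y₀ hy₀)) := by
    rw [hτQ]; rw [sigmaChart_invSelf]
  have hσC : ∀ a : k, conj Φ₂ (sigmaChart 𝒜P (![algebraMap (MvPolynomial (Option (Fin 4)) k) (Localization.Away hh₁) (X (some 0)), algebraMap (MvPolynomial (Option (Fin 4)) k) (Localization.Away hh₁) (X (some 2))] : Fin 2 → Localization.Away hh₁) ![2, 1] (d₂ * (d * (2 * p))) y₀ hy₀ τP hσJ₂ hp.pos hσp₂ hσy₀) (algebraMap (MvPolynomial (Option (Option (Fin 4))) k) _ (C a)) = algebraMap (MvPolynomial (Option (Option (Fin 4))) k) _ (C a) := by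
    intro a
    rw [← hΦC, hτQ]
    rw [sigmaChart_algebraMap, sigmaR_algebraMap, ← MvPolynomial.algebraMap_eq, ← IsScalarTower.algebraMap_apply k (MvPolynomial (Option (Fin 4)) k) (Localization.Away hh₁) a,
      r5 _ (Set.mem_union_right _ ⟨a, rfl⟩)]
  have hσh' : conj Φ₂ (sigmaChart 𝒜P (![algebraMap (MvPolynomial (Option (Fin 4)) k) (Localization.Away hh₁) (X (some 0)), algebraMap (MvPolynomial (Option (Fin 4)) k) (Localization.Away hh₁) (X (some 2))] : Fin 2 → Localization.Away hh₁) ![2, 1] (d₂ * (d * (2 * p))) y₀ hy₀ τP hσJ₂ hp.pos hσp₂ hσy₀) (algebraMap (MvPolynomial (Option (Option (Fin 4))) k) _ (cobordantAlgebra.subst k (fun o : Option (Fin 4) => Option.elim o 0 ![2, 0, 1, 0]) hh₁)) =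
      algebraMap (MvPolynomial (Option (Option (Fin 4))) k) _ (cobordantAlgebra.subst k (fun o : Option (Fin 4) => Option.elim o 0 ![2, 0, 1, 0]) hh₁) := by
    rw [← hΦa, hτQ]
    rw [sigmaChart_algebraMap, sigmaR_algebraMap, rh]
  have hσh : conj Φ₂ (sigmaChart 𝒜P (![algebraMap (MvPolynomial (Option (Fin 4)) k) (Localization.Away hh₁) (X (some 0)), algebraMap (MvPolynomial (Option (Fin 4)) k) (Localization.Away hh₁) (X (some 2))] : Fin 2 → Localization.Away hh₁) ![2, 1] (d₂ * (d * (2 * p))) y₀ hy₀ τP hσJ₂ hp.pos hσp₂ hσy₀) (algebraMap (MvPolynomial (Option (Option (Fin 4))) k) _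
      (cobordantAlgebra.subst k (fun o : Option (Fin 4) => Option.elim o 0 ![2, 0, 1, 0]) hh₁ * X (some (some 0)) ^ (d * p * d₂))) =
      algebraMap (MvPolynomial (Option (Option (Fin 4))) k) _ (cobordantAlgebra.subst k (fun o : Option (Fin 4) => Option.elim o 0 ![2, 0, 1, 0]) hh₁ * X (some (some 0)) ^ (d * p * d₂)) := by
    simp only [map_mul, map_pow, hσh', hσY0]
  have hσhinv : conj Φ₂ (sigmaChart 𝒜P (![algebraMap (MvPolynomial (Option (Fin 4)) k) (Localization.Away hh₁) (X (some 0)), algebraMap (MvPolynomial (Option (Fin 4)) k) (Localization.Away hh₁) (X (some 2))] : Fin 2 → Localization.Away hh₁) ![2, 1] (d₂ * (d * (2 * p))) y₀ hy₀ τP hσJ₂ hp.pos hσp₂ hσy₀) (IsLocalization.Away.invSelf (cobordantAlgebra.subst k (fun o : Option (Fin 4) => Option.elim o 0 ![2, 0, 1, 0]) hh₁ * X (some (some 0)) ^ (d * p * d₂))) =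
      IsLocalization.Away.invSelf (cobordantAlgebra.subst k (fun o : Option (Fin 4) => Option.elim o 0 ![2, 0, 1, 0]) hh₁ * X (some (some 0)) ^ (d * p * d₂)) :=
    apply_eq_of_mul_eq_one _ (IsLocalization.Away.mul_invSelf _) hσh
  have hfix : ∀ g' ∈ (({IsLocalization.Away.invSelf (cobordantAlgebra.subst k (fun o : Option (Fin 4) => Option.elim o 0 ![2, 0, 1, 0]) hh₁ * X (some (some 0)) ^ (d * p * d₂))} :
        Set _) ∪ Set.range (algebraMap k _)), conj Φ₂ (sigmaChart 𝒜P (![algebraMap (MvPolynomial (Option (Fin 4)) k) (Localization.Away hh₁) (X (some 0)), algebraMap (MvPolynomial (Option (Fin 4)) k) (Localization.Away hh₁) (X (some 2))] : Fin 2 → Localization.Away hh₁) ![2, 1] (d₂ * (d * (2 * p))) y₀ hy₀ τP hσJ₂ hp.pos hσp₂ hσy₀) g' = g' := by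
    rintro g' (rfl | ⟨a, rfl⟩)
    · exact hσhinv
    · rw [IsScalarTower.algebraMap_apply k (MvPolynomial (Option (Option (Fin 4))) k) _ a, MvPolynomial.algebraMap_eq, hσC]
  -- ### generation, units, characteristic of `Q`
  have hgen := closure_range_X_invSelf_eq_top k (cobordantAlgebra.subst k (fun o : Option (Fin 4) => Option.elim o 0 ![2, 0, 1, 0]) hh₁ * X (some (some 0)) ^ (d * p * d₂))
  have hgen' : Subring.closure (({algebraMap (MvPolynomial (Option (Option (Fin 4))) k) _ (X none), algebraMap (MvPolynomial (Option (Option (Fin 4))) k) _ (X (some (some 0))),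
        algebraMap (MvPolynomial (Option (Option (Fin 4))) k) _ (X (some (some 1))), algebraMap (MvPolynomial (Option (Option (Fin 4))) k) _ (X (some (some 2))),
        algebraMap (MvPolynomial (Option (Option (Fin 4))) k) _ (X (some (some 3))), algebraMap (MvPolynomial (Option (Option (Fin 4))) k) _ (X (some none))} :
        Set (Localization.Away (cobordantAlgebra.subst k (fun o : Option (Fin 4) => Option.elim o 0 ![2, 0, 1, 0]) hh₁ * X (some (some 0)) ^ (d * p * d₂)))) ∪
      (({IsLocalization.Away.invSelf (cobordantAlgebra.subst k (fun o : Option (Fin 4) => Option.elim o 0 ![2, 0, 1, 0]) hh₁ * X (some (some 0)) ^ (d * p * d₂))} : Set _) ∪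
        Set.range (algebraMap k _))) = ⊤ := by
    refine top_le_iff.mp (hgen.ge.trans (Subring.closure_mono (Set.union_subset_union_left _ ?_)))
    rintro _ ⟨o, rfl⟩
    rcases o with _ | _ | o
    · simp
    · simp
    · fin_cases o <;> simp
  have hsubh : cobordantAlgebra.subst k (fun o : Option (Fin 4) => Option.elim o 0 ![2, 0, 1, 0]) hh₁ = (∏ j : ZMod p, (X (some (some 1)) + C (j.val : k) * (X none ^ 2 * X (some (some 0)) * X (some none)))) ^ (2 * d) := by
    rw [hhh₁, map_pow, map_prod]
    refine congrArg (· ^ (2 * d)) (Finset.prod_congr rfl fun j _ => ?_)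
    rw [map_add, map_mul, map_mul, hsub, hsub, hsub, cobordantAlgebra.subst, MvPolynomial.eval₂Hom_C]
    change X none ^ 0 * _ + _ * (X none ^ 2 * _ * (X none ^ 0 * _)) = _
    simp only [pow_zero, one_mul]
  have hX1u : IsUnit (algebraMap (MvPolynomial (Option (Option (Fin 4))) k)
      (Localization.Away (cobordantAlgebra.subst k (fun o : Option (Fin 4) => Option.elim o 0 ![2, 0, 1, 0]) hh₁ * X (some (some 0)) ^ (d * p * d₂))) (X (some (some 1)))) := by
    have hdvd : (X (some (some 1)) : MvPolynomial (Option (Option (Fin 4))) k) ∣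
        cobordantAlgebra.subst k (fun o : Option (Fin 4) => Option.elim o 0 ![2, 0, 1, 0]) hh₁ * X (some (some 0)) ^ (d * p * d₂) := by
      refine Dvd.dvd.mul_right ?_ _
      rw [hsubh]
      refine Dvd.dvd.trans ?_ (dvd_pow_self _ (Nat.mul_ne_zero two_ne_zero hd.ne'))
      have hfac : (X (some (some 1)) : MvPolynomial (Option (Option (Fin 4))) k) = X (some (some 1)) + C (((0 : ZMod p).val : k)) * (X none ^ 2 * X (some (some 0)) * X (some none)) := by
        rw [ZMod.val_zero, Nat.cast_zero, C_0, zero_mul, add_zero]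
      conv_lhs => rw [hfac]
      exact Finset.dvd_prod_of_mem _ (Finset.mem_univ (0 : ZMod p))
    exact isUnit_of_dvd_unit (map_dvd _ hdvd) (IsLocalization.Away.algebraMap_isUnit _)
  have hY0u : IsUnit (algebraMap (MvPolynomial (Option (Option (Fin 4))) k)
      (Localization.Away (cobordantAlgebra.subst k (fun o : Option (Fin 4) => Option.elim o 0 ![2, 0, 1, 0]) hh₁ * X (some (some 0)) ^ (d * p * d₂))) (X (some (some 0)))) := by
    have hdvd : (X (some (some 0)) : MvPolynomial (Option (Option (Fin 4))) k) ∣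
        cobordantAlgebra.subst k (fun o : Option (Fin 4) => Option.elim o 0 ![2, 0, 1, 0]) hh₁ * X (some (some 0)) ^ (d * p * d₂) :=
      Dvd.dvd.mul_left (dvd_pow_self _ (Nat.mul_pos hdp hd₂).ne') _
    exact isUnit_of_dvd_unit (map_dvd _ hdvd) (IsLocalization.Away.algebraMap_isUnit _)
  have hηu₃ : IsUnit (Φ₂ (algebraMap ↥(cobordantAlgebra (![algebraMap (MvPolynomial (Option (Fin 4)) k) (Localization.Away hh₁) (X (some 0)), algebraMap (MvPolynomial (Option (Fin 4)) k) (Localization.Away hh₁) (X (some 2))] : Fin 2 → Localization.Away hh₁) ![2, 1]) (ChartRing 𝒜P (![algebraMap (MvPolynomial (Option (Fin 4)) k) (Localization.Away hh₁) (X (some 0)), algebraMap (MvPolynomial (Option (Fin 4)) k) (Localization.Away hh₁) (X (some 2))] : Fin 2 → Localization.Away hh₁) ![2, 1] (d₂ * (d * (2 * p))) y₀ hy₀) (algebraMap (Localization.Away hh₁) ↥(cobordantAlgebra (![algebraMap (MvPolynomial (Option (Fin 4)) k) (Localization.Away hh₁) (X (some 0)), algebraMap (MvPolynomial (Option (Fin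 4)) k) (Localization.Away hh₁) (X (some 2))] : Fin 2 → Localization.Away hh₁) ![2, 1]) (IsLocalization.Away.invSelf hh₁)))) := ((hηu.map _).map _).map Φ₂
  have hκu : IsUnit (Φ₂ (IsLocalization.Away.invSelf (coverElement 𝒜P _ ![2, 1] (d₂ * (d * (2 * p))) y₀ hy₀))) :=
    (IsUnit.of_mul_eq_one (algebraMap _ (ChartRing 𝒜P _ ![2, 1] (d₂ * (d * (2 * p))) y₀ hy₀) (coverElement 𝒜P _ ![2, 1] (d₂ * (d * (2 * p))) y₀ hy₀))
      ((mul_comm _ _).trans (IsLocalization.Away.mul_invSelf _))).map Φ₂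
  -- a point of `V(s₂, Y₂, s)` with `h₃ ≠ 0`
  have hg₃ : ∀ i, (fun o : Option (Option (Fin 4)) => if o = some (some 0) ∨ o = some (some 1) then (1 : k) else 0)
      ((![none, some (some 2), some none] : Fin 3 → Option (Option (Fin 4))) i) = 0 := by
    intro i; fin_cases i <;> exact if_neg (by decide)
  have hu₃ : MvPolynomial.eval (fun o : Option (Option (Fin 4)) => if o = some (some 0) ∨ o = some (some 1) then (1 : k) else 0)
      (cobordantAlgebra.subst k (fun o : Option (Fin 4) => Option.elim o 0 ![2, 0, 1, 0]) hh₁ * X (some (some 0)) ^ (d * p * d₂)) ≠ 0 := by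
    rw [hsubh]
    simp
  haveI hcharQ := charP_away_of_eval_ne_zero p _ _ hu₃
  have hv₃ : Function.Injective (![none, some (some 2), some none] : Fin 3 → Option (Option (Fin 4))) := by
    intro i j hij; fin_cases i <;> fin_cases j <;> first | rfl | exact absurd hij (by decide)
  have hfv₃ : (fun i => algebraMap (MvPolynomial (Option (Option (Fin 4))) k)
      (Localization.Away (cobordantAlgebra.subst k (fun o : Option (Fin 4) => Option.elim o 0 ![2, 0, 1, 0]) hh₁ * X (some (some 0)) ^ (d * p * d₂)))
      (X ((![none, some (some 2), some none] : Fin 3 → Option (Option (Fin 4))) i))) =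
      ![algebraMap (MvPolynomial (Option (Option (Fin 4))) k) _ (X none), algebraMap (MvPolynomial (Option (Option (Fin 4))) k) _ (X (some (some 2))),
        algebraMap (MvPolynomial (Option (Option (Fin 4))) k) _ (X (some none))] := by
    funext i; fin_cases i <;> rfl
  have hK1₃ := isRegular_algebraMap_X_away k _ _ hv₃ _ hg₃ hu₃
  have hK1'₃ := isRegularRing_quotient_X_away k (cobordantAlgebra.subst k (fun o : Option (Fin 4) => Option.elim o 0 ![2, 0, 1, 0]) hh₁ * X (some (some 0)) ^ (d * p * d₂))
    (![none, some (some 2), some none] : Fin 3 → Option (Option (Fin 4)))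
  rw [hfv₃] at hK1₃ hK1'₃
  -- ### degrees in the transported grading of `Q`
  have hds₂ : algebraMap (MvPolynomial (Option (Option (Fin 4))) k) _ (X none) ∈ mapGrading (chartNodeGrading r 𝒜P (![algebraMap (MvPolynomial (Option (Fin 4)) k) (Localization.Away hh₁) (X (some 0)), algebraMap (MvPolynomial (Option (Fin 4)) k) (Localization.Away hh₁) (X (some 2))] : Fin 2 → Localization.Away hh₁) ![2, 1] hf₂ (d₂ * (d * (2 * p))) y₀ hy₀) Φ₂ (-consIndexEquiv r ((1 : ℤ), 0)) := by
    rw [← hΦs, ← neg_one_zsmul, ← consIndexEquiv_int_zero]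
    exact map_algebraMap_mem_mapGrading r 𝒜P _ ![2, 1] hf₂ _ y₀ hy₀ Φ₂ (s_mem_reesPiece 𝒜P _ _)
  have hdY₀ : algebraMap (MvPolynomial (Option (Option (Fin 4))) k) _ (X (some (some 0))) ∈
      mapGrading (chartNodeGrading r 𝒜P (![algebraMap (MvPolynomial (Option (Fin 4)) k) (Localization.Away hh₁) (X (some 0)), algebraMap (MvPolynomial (Option (Fin 4)) k) (Localization.Away hh₁) (X (some 2))] : Fin 2 → Localization.Away hh₁) ![2, 1] hf₂ (d₂ * (d * (2 * p))) y₀ hy₀) Φ₂ (2 • consIndexEquiv r ((1 : ℤ), 0) + 2 • consIndexEquiv r ((0 : ℤ), θ)) := by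
    rw [← hΦY0, ← consIndexEquiv_zero_nsmul, ← natCast_zsmul (consIndexEquiv r ((1 : ℤ), 0)) 2, ← consIndexEquiv_pair]
    exact map_algebraMap_mem_mapGrading r 𝒜P _ ![2, 1] hf₂ _ y₀ hy₀ Φ₂ (u'_mem_reesPiece 𝒜P _ _ hf₂ 0)
  have hdY₂ : algebraMap (MvPolynomial (Option (Option (Fin 4))) k) _ (X (some (some 2))) ∈ mapGrading (chartNodeGrading r 𝒜P (![algebraMap (MvPolynomial (Option (Fin 4)) k) (Localization.Away hh₁) (X (some 0)), algebraMap (MvPolynomial (Option (Fin 4)) k) (Localization.Away hh₁) (X (some 2))] : Fin 2 → Localization.Away hh₁) ![2, 1] hf₂ (d₂ * (d * (2 * p))) y₀ hy₀) Φ₂ (consIndexEquiv r ((1 : ℤ), 0)) := by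
    rw [← hΦY2]
    exact map_algebraMap_mem_mapGrading r 𝒜P _ ![2, 1] hf₂ _ y₀ hy₀ Φ₂ (u'_mem_reesPiece 𝒜P _ _ hf₂ 1)
  have hds : algebraMap (MvPolynomial (Option (Option (Fin 4))) k) _ (X (some none)) ∈ mapGrading (chartNodeGrading r 𝒜P (![algebraMap (MvPolynomial (Option (Fin 4)) k) (Localization.Away hh₁) (X (some 0)), algebraMap (MvPolynomial (Option (Fin 4)) k) (Localization.Away hh₁) (X (some 2))] : Fin 2 → Localization.Away hh₁) ![2, 1] hf₂ (d₂ * (d * (2 * p))) y₀ hy₀) Φ₂ (-consIndexEquiv r ((0 : ℤ), θ)) := by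
    rw [← hΦs₁, ← consIndexEquiv_zero_neg]
    exact map_algebraMap_mem_mapGrading r 𝒜P _ ![2, 1] hf₂ _ y₀ hy₀ Φ₂ (algebraMap_mem_reesPiece 𝒜P _ _ dgs)
  have hdη : Φ₂ (algebraMap ↥(cobordantAlgebra (![algebraMap (MvPolynomial (Option (Fin 4)) k) (Localization.Away hh₁) (X (some 0)), algebraMap (MvPolynomial (Option (Fin 4)) k) (Localization.Away hh₁) (X (some 2))] : Fin 2 → Localization.Away hh₁) ![2, 1]) (ChartRing 𝒜P (![algebraMap (MvPolynomial (Option (Fin 4)) k) (Localization.Away hh₁) (X (some 0)), algebraMap (MvPolynomial (Option (Fin 4)) k) (Localization.Away hh₁) (X (some 2))] : Fin 2 → Localization.Away hh₁) ![2, 1] (d₂ * (d * (2 * p))) y₀ hy₀) (algebraMap (Localization.Away hh₁) ↥(cobordantAlgebra (![algebraMap (MvPolynomial (Option (Fin 4)) k) (Localization.Away hh₁) (X (some 0)), algebraMap (MvPolynomial (Option (Fin 4)) k) (Localization.Away hh₁) (X (some 2))] : Fin 2 → Localization.Away hh₁) ![2, 1]) (IsLocalization.Away.invSelf hh₁)))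 ∈
      mapGrading (chartNodeGrading r 𝒜P (![algebraMap (MvPolynomial (Option (Fin 4)) k) (Localization.Away hh₁) (X (some 0)), algebraMap (MvPolynomial (Option (Fin 4)) k) (Localization.Away hh₁) (X (some 2))] : Fin 2 → Localization.Away hh₁) ![2, 1] hf₂ (d₂ * (d * (2 * p))) y₀ hy₀) Φ₂ (-((d * (2 * p)) • consIndexEquiv r ((0 : ℤ), θ))) := by
    rw [← consIndexEquiv_zero_nsmul, ← consIndexEquiv_zero_neg]
    exact map_algebraMap_mem_mapGrading r 𝒜P _ ![2, 1] hf₂ _ y₀ hy₀ Φ₂ (algebraMap_mem_reesPiece 𝒜P _ _ dgη)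
  have hdκ : Φ₂ (IsLocalization.Away.invSelf (coverElement 𝒜P _ ![2, 1] (d₂ * (d * (2 * p))) y₀ hy₀)) ∈
      mapGrading (chartNodeGrading r 𝒜P (![algebraMap (MvPolynomial (Option (Fin 4)) k) (Localization.Away hh₁) (X (some 0)), algebraMap (MvPolynomial (Option (Fin 4)) k) (Localization.Away hh₁) (X (some 2))] : Fin 2 → Localization.Away hh₁) ![2, 1] hf₂ (d₂ * (d * (2 * p))) y₀ hy₀) Φ₂ (-((d₂ * (d * (2 * p))) • consIndexEquiv r ((1 : ℤ), 0))) := by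
    rw [← natCast_zsmul (consIndexEquiv r ((1 : ℤ), 0)), ← neg_zsmul, ← consIndexEquiv_int_zero]
    exact map_invSelf_mem_mapGrading r 𝒜P _ ![2, 1] hf₂ _ y₀ hy₀ Φ₂
  -- ### the closedness datum: the ratio section and the pulled-back section
  have hJs₂ : algebraMap (MvPolynomial (Option (Option (Fin 4))) k) (Localization.Away (cobordantAlgebra.subst k (fun o : Option (Fin 4) => Option.elim o 0 ![2, 0, 1, 0]) hh₁ *
      X (some (some 0)) ^ (d * p * d₂))) (X none) ∈ (weightedFiltration (![algebraMap (MvPolynomial (Option (Option (Fin 4))) k) _ (X none),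
        algebraMap (MvPolynomial (Option (Option (Fin 4))) k) _ (X (some (some 2))), algebraMap (MvPolynomial (Option (Option (Fin 4))) k) _ (X (some none))] :
        Fin 3 → _) ![1, 1, 2]).ideal 1 := mem_weightedFiltration_ideal (![_, _, _] : Fin 3 → _) ![1, 1, 2] 0
  have hJY₂ : algebraMap (MvPolynomial (Option (Option (Fin 4))) k) (Localization.Away (cobordantAlgebra.subst k (fun o : Option (Fin 4) => Option.elim o 0 ![2, 0, 1, 0]) hh₁ *
      X (some (some 0)) ^ (d * p * d₂))) (X (some (some 2))) ∈ (weightedFiltration (![algebraMap (MvPolynomial (Option (Option (Fin 4))) k) _ (X none),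
        algebraMap (MvPolynomial (Option (Option (Fin 4))) k) _ (X (some (some 2))), algebraMap (MvPolynomial (Option (Option (Fin 4))) k) _ (X (some none))] :
        Fin 3 → _) ![1, 1, 2]).ideal 1 := mem_weightedFiltration_ideal (![_, _, _] : Fin 3 → _) ![1, 1, 2] 1
  have hu₂val : Φ₂ ((E₂ u₂ : ↥(chartNodeGrading r 𝒜P (![algebraMap (MvPolynomial (Option (Fin 4)) k) (Localization.Away hh₁) (X (some 0)), algebraMap (MvPolynomial (Option (Fin 4)) k) (Localization.Away hh₁) (X (some 2))] : Fin 2 → Localization.Away hh₁) ![2, 1] hf₂ (d₂ * (d * (2 * p))) y₀ hy₀ 0)) : ChartRing 𝒜P (![algebraMap (MvPolynomial (Option (Fin 4)) k) (Localization.Away hh₁) (X (some 0)), algebraMap (MvPolynomial (Option (Fin 4)) k) (Localization.Away hh₁) (X (some 2))] : Fin 2 → Localization.Away hh₁) ![2, 1] (d₂ * (d * (2 * p))) y₀ hy₀) ∈ (weightedFiltration (![algebraMap (MvPolynomial (Option (Option (Fin 4))) k) _ (X none),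
        algebraMap (MvPolynomial (Option (Option (Fin 4))) k) _ (X (some (some 2))), algebraMap (MvPolynomial (Option (Option (Fin 4))) k) _ (X (some none))] :
        Fin 3 → _) ![1, 1, 2]).ideal 1 := by
    rw [hu₂v, map_mul, A1.a1m2_coverElement_one_eq _ _ _ d d₂ c₁ hc₁]
    refine Ideal.mul_mem_right _ _ ?_
    simp only [map_pow]
    refine Ideal.pow_mem_of_mem _ ?_ _ (Nat.mul_pos (Nat.mul_pos two_pos hd) hd₂)
    simp only [map_prod]
    rw [← Finset.mul_prod_erase Finset.univ _ (Finset.mem_univ (0 : ZMod p))]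
    refine Ideal.mul_mem_right _ _ ?_
    simp only [map_add, map_mul, map_pow, hΦY2, hΦs, hΦY0]
    exact add_mem hJY₂ (Ideal.mul_mem_left _ _ (Ideal.mul_mem_right _ _ hJs₂))
  have hu₁val : Φ₂ ((E₂ u₁ : ↥(chartNodeGrading r 𝒜P (![algebraMap (MvPolynomial (Option (Fin 4)) k) (Localization.Away hh₁) (X (some 0)), algebraMap (MvPolynomial (Option (Fin 4)) k) (Localization.Away hh₁) (X (some 2))] : Fin 2 → Localization.Away hh₁) ![2, 1] hf₂ (d₂ * (d * (2 * p))) y₀ hy₀ 0)) : ChartRing 𝒜P (![algebraMap (MvPolynomial (Option (Fin 4)) k) (Localization.Away hh₁) (X (some 0)), algebraMap (MvPolynomial (Option (Fin 4)) k) (Localization.Away hh₁) (X (some 2))] : Fin 2 → Localization.Away hh₁) ![2, 1] (d₂ * (d * (2 * p))) y₀ hy₀) ∈ (weightedFiltration (![algebraMap (MvPolynomial (Option (Option (Fin 4))) k) _ (X none),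
        algebraMap (MvPolynomial (Option (Option (Fin 4))) k) _ (X (some (some 2))), algebraMap (MvPolynomial (Option (Option (Fin 4))) k) _ (X (some none))] :
        Fin 3 → _) ![1, 1, 2]).ideal 1 := by
    rw [hu₁v]
    change Φ₂ (algebraMap ↥(cobordantAlgebra (![algebraMap (MvPolynomial (Option (Fin 4)) k) (Localization.Away hh₁) (X (some 0)), algebraMap (MvPolynomial (Option (Fin 4)) k) (Localization.Away hh₁) (X (some 2))] : Fin 2 → Localization.Away hh₁) ![2, 1]) (ChartRing 𝒜P (![algebraMap (MvPolynomial (Option (Fin 4)) k) (Localization.Away hh₁) (X (some 0)), algebraMap (MvPolynomial (Option (Fin 4)) k) (Localization.Away hh₁) (X (some 2))] : Fin 2 → Localization.Away hh₁) ![2, 1] (d₂ * (d * (2 * p))) y₀ hy₀) (algebraMap (Localization.Away hh₁) ↥(cobordantAlgebra (![algebraMap (MvPolynomial (Option (Fin 4)) k) (Localization.Away hh₁) (X (some 0)), algebraMap (MvPolynomial (Option (Fin 4)) k) (Localization.Away hh₁) (X (some 2))] : Fin 2 → Localization.Away hh₁) ![2, 1]) ((x₁ : Localization.Away hh₁))))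 ∈ _
    rw [hx₁v]
    have hX₀R : algebraMap (Localization.Away hh₁) ↥(cobordantAlgebra (![algebraMap (MvPolynomial (Option (Fin 4)) k) (Localization.Away hh₁) (X (some 0)),
        algebraMap (MvPolynomial (Option (Fin 4)) k) (Localization.Away hh₁) (X (some 2))] : Fin 2 → Localization.Away hh₁) ![2, 1])
        (algebraMap (MvPolynomial (Option (Fin 4)) k) (Localization.Away hh₁) (X (some 0))) = cobordantAlgebra.s _ ![2, 1] ^ 2 * cobordantAlgebra.u' _ ![2, 1] 0 :=
      cobordantAlgebra.algebraMap_u (![algebraMap (MvPolynomial (Option (Fin 4)) k) (Localization.Away hh₁) (X (some 0)),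
        algebraMap (MvPolynomial (Option (Fin 4)) k) (Localization.Away hh₁) (X (some 2))] : Fin 2 → Localization.Away hh₁) ![2, 1] 0
    simp only [map_mul, map_pow]
    rw [hX₀R]
    simp only [map_mul, map_pow]
    rw [hΦs, hΦY0]
    refine Ideal.mul_mem_right _ _ (Ideal.pow_mem_of_mem _ (Ideal.mul_mem_right _ _ (Ideal.pow_mem_of_mem _ hJs₂ _ two_pos)) _ hdp)
  -- ### move 3
  obtain ⟨𝒦₃, d₃, -, hadm₃, hkill⟩ := a1_move3 hp hG M₂ W₂
    ({ affine := hW₂aff, m := m + 1, r := Fin.cons 0 r, B := ChartRing 𝒜P (![algebraMap (MvPolynomial (Option (Fin 4)) k) (Localization.Away hh₁) (X (some 0)), algebraMap (MvPolynomial (Option (Fin 4)) k) (Localization.Away hh₁) (X (some 2))] : Fin 2 → Localization.Away hh₁) ![2, 1] (d₂ * (d * (2 * p))) y₀ hy₀, 𝒜 := chartNodeGrading r 𝒜P (![algebraMap (MvPolynomial (Option (Fin 4)) k) (Localization.Away hh₁) (X (some 0)), algebraMap (MvPolynomial (Option (Fin 4)) k) (Localization.Away hh₁) (X (some 2))] :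 Fin 2 → Localization.Away hh₁) ![2, 1] hf₂ (d₂ * (d * (2 * p))) y₀ hy₀,
        σ := sigmaChart 𝒜P (![algebraMap (MvPolynomial (Option (Fin 4)) k) (Localization.Away hh₁) (X (some 0)), algebraMap (MvPolynomial (Option (Fin 4)) k) (Localization.Away hh₁) (X (some 2))] : Fin 2 → Localization.Away hh₁) ![2, 1] (d₂ * (d * (2 * p))) y₀ hy₀ τP hσJ₂ hp.pos hσp₂ hσy₀, e := E₂, tame := htame₂, intertwine := hE₂ } : NodeData p M₂.act g₀ W₂)
    Φ₂ (conj Φ₂ (sigmaChart 𝒜P (![algebraMap (MvPolynomial (Option (Fin 4)) k) (Localization.Away hh₁) (X (some 0)), algebraMap (MvPolynomial (Option (Fin 4)) k) (Localization.Away hh₁) (X (some 2))] : Fin 2 → Localization.Away hh₁) ![2, 1] (d₂ * (d * (2 * p))) y₀ hy₀ τP hσJ₂ hp.pos hσp₂ hσy₀)) (fun _ => rfl)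
    (algebraMap (MvPolynomial (Option (Option (Fin 4))) k) _ (X none)) (algebraMap (MvPolynomial (Option (Option (Fin 4))) k) _ (X (some (some 0))))
    (algebraMap (MvPolynomial (Option (Option (Fin 4))) k) _ (X (some (some 1)))) (algebraMap (MvPolynomial (Option (Option (Fin 4))) k) _ (X (some (some 2))))
    (algebraMap (MvPolynomial (Option (Option (Fin 4))) k) _ (X (some (some 3)))) (algebraMap (MvPolynomial (Option (Option (Fin 4))) k) _ (X (some none)))
    (Φ₂ (algebraMap ↥(cobordantAlgebra (![algebraMap (MvPolynomial (Option (Fin 4)) k) (Localization.Away hh₁) (X (some 0)), algebraMap (MvPolynomial (Option (Fin 4)) k) (Localization.Away hh₁) (X (some 2))] : Fin 2 → Localization.Away hh₁) ![2, 1]) (ChartRing 𝒜P (![algebraMap (MvPolynomial (Option (Fin 4)) k) (Localization.Away hh₁) (X (some 0)), algebraMap (MvPolynomial (Option (Fin 4)) k) (Localization.Away hh₁) (X (some 2))] : Fin 2 → Localization.Away hh₁) ![2, 1] (d₂ * (d * (2 * p))) y₀ hy₀) (algebraMap (Localization.Away hh₁) ↥(cobordantAlgebra (![algebraMap (MvPolynomial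 (Option (Fin 4)) k) (Localization.Away hh₁) (X (some 0)), algebraMap (MvPolynomial (Option (Fin 4)) k) (Localization.Away hh₁) (X (some 2))] : Fin 2 → Localization.Away hh₁) ![2, 1]) (IsLocalization.Away.invSelf hh₁))))
    (Φ₂ (IsLocalization.Away.invSelf (coverElement 𝒜P _ ![2, 1] (d₂ * (d * (2 * p))) y₀ hy₀))) _
    hσs₂ hσY0 hσX1 hσY2 hσx3 hσs hση hσκ hfix hgen' hX1u hY0u hηu₃ hκu
    (consIndexEquiv r ((0 : ℤ), θ)) (consIndexEquiv r ((1 : ℤ), 0)) d d₂ hd hd₂ hds₂ hdY₀ hdY₂ hds hdη hdκ hK1₃ hK1'₃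
    (![W₂', U₁]) (fun x => by
      rcases hcov x with h | h | h
      · exact Or.inl h
      · exact Or.inr ⟨0, h⟩
      · exact Or.inr ⟨1, h⟩)
    (![u₂, u₁]) (fun _ => 1) (fun _ => one_pos)
    (fun i => by
      fin_cases i
      · exact hu₂val
      · exact hu₁val)
    (fun i => by
      fin_cases i
      · exact hu₂U
      · exact hu₁U)
    𝔄₂ hF₂
  refine ⟨𝒦₃, d₃, hadm₃, fun M₃ hm₃ => ⟨⟨NodeAtlasData.ofNodeAtlas (p := p) (ρ := M₃.act) (g₀ := g₀) M₃.atlas⟩, ?_⟩⟩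
  obtain ⟨π₃, hbl₃, -, hr₃, hcomm₃⟩ := hm₃
  exact hkill M₃ π₃ hbl₃ hr₃ hcomm₃

end Summit.ResolutionOfSingularities.ResolutionOfSingularities.Theorems.WildQuotientResolution.S1.GameFrame.GModel

end
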